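import Summits.ResolutionOfSingularities.ResolutionOfSingularities.Theorems.WildQuotientsSummitReductionStubPairQuasiSplitNormalFormLemmas
import Literature.AlgebraicGeometry.Resolution.AlterationsFormalNodesSingProofs
import Literature.AlgebraicGeometry.Resolution.AlterationsFormalCoordinates
import Literature.AlgebraicGeometry.Resolution.StrictNormalCrossingsAt
import Literature.AlgebraicGeometry.Resolution.AdicCompletionRegular
import HarnessLib

/-!
# `WildQuotients.SummitReduction` (stmt-ResolutionOfSingularities-16324), line `FramePerfect`, skeleton v8:
# stub `stub_pair_quasiSplitNormalForm` (N) — helper file 5: de Jong 1996, 4.24 [B2] / 4.25 (i) at the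
# closed points of the SMOOTH locus, over an arbitrary field, in the `IsSNCIdeal` form

Route `ResolutionOfSingularities/WildQuotients`, crux `SummitReduction`; sub-goals of the registered
stub `stub_pair_quasiSplitNormalForm` of the line skeleton `Cruxes/SummitReduction/Lines/FramePerfect.lean`
(v8, lead c4). Worker file.

De Jong 1996, 4.24 (p. 75): "(Of course the sections `τᵢ` still map into the smooth locus of `f`;
in fact, `Z` is already everywhere a divisor with normal crossings, except in the singular points of
`X`. …)" At the closed points of the smooth locus of `f` the tree proves this in strict Zariski-local
form over an ALGEBRAICALLY CLOSED field (`SemiStablePair.exists_rsop_stalkIdeal_boundary_of_smooth`,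
`AlterationsBoundarySmoothLocus.lean`): `𝒪_{X,x}` has a regular system of parameters `z₁, …, z_d`
with `I(Z)_x = (z₁ ⋯ z_r)`. Algebraic closedness enters only through the fibre dimension at `x` and
the principality of the germ of a section, both available over any field from
`…StubPairQuasiSplitNormalFormLemmas.lean`. This file re-runs the tree's proof with these inputs
and concludes in the form required by `DeJong1997.QuasiSplitNormalFormPair` (field
`isSNCIdeal_completedStalkIdeal`): the completed ideal of `Z` in `𝒪̂_{X,x}` has local strict normal
crossings data (`IsSNCIdeal`).

* `isSNCIdeal_map_algebraMap_adicCompletion` — `IsSNCIdeal` passes to the completion;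
* `isSNCIdeal_span_prod_filter_lt` — `(z₁ ⋯ z_r)` for a regular system of parameters `z` is an
  SNC ideal;
* `exists_rsop_stalkIdeal_boundary_of_smooth'` — the tree's regular system of parameters at a
  closed point of the smooth locus, over any field;
* `isSNCIdeal_completedStalkIdeal_boundary_of_smooth` — 4.25 (i) at these points.
-/

set_option linter.dupNamespace false

noncomputable section

open CategoryTheory CategoryTheory.Limits AlgebraicGeometry TopologicalSpace Topology
open Literature.AlgebraicGeometry.Resolution
open Literature.AlgebraicGeometry
open IsLocalRing Scheme.IdealSheafData

namespace Summit.ResolutionOfSingularities.ResolutionOfSingularities.Theorems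

universe u

/-! ## `IsSNCIdeal`: completion and products of parameters -/

/-- **Local strict normal crossings data pass to the completion**: if `I = (x₁ ⋯ x_r)` for a
regular system of parameters `x, y` of the regular local ring `A`, then `I Â = (x̂₁ ⋯ x̂_r)` for the
regular system of parameters `x̂, ŷ` of the regular local ring `Â` (same dimension, `𝔪_Â = 𝔪 Â`).
[cite: Matsumura1987, §19 p. 158 (proof of Thm. 19.5)] -/
theorem isSNCIdeal_map_algebraMap_adicCompletion {A : Type u} [CommRing A] [IsLocalRing A]
    [IsNoetherianRing A] {I : Ideal A} (h : IsSNCIdeal I) :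
    IsSNCIdeal (I.map (algebraMap A (AdicCompletion (maximalIdeal A) A))) := by
  obtain ⟨hreg, r, e, x, y, hr, hdim, hspan, rfl⟩ := h
  haveI := hreg
  haveI : IsRegularLocalRing (AdicCompletion (maximalIdeal A) A) := isRegularLocalRing_adicCompletion A
  refine ⟨inferInstance, r, e, fun i => algebraMap A _ (x i), fun i => algebraMap A _ (y i), hr,
    ?_, ?_, ?_⟩
  · rw [ringKrullDim_adicCompletion, hdim]
  · have h1 : (Set.range fun i => algebraMap A (AdicCompletion (maximalIdeal A) A) (x i)) ∪
        (Set.range fun i => algebraMap A (AdicCompletion (maximalIdeal A) A) (y i)) =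
        algebraMap A (AdicCompletion (maximalIdeal A) A) '' (Set.range x ∪ Set.range y) := by
      rw [Set.image_union, ← Set.range_comp, ← Set.range_comp]
      rfl
    rw [h1, ← Ideal.map_span, hspan, AdicCompletion.maximalIdeal_eq_map]
  · rw [Ideal.map_span, Set.image_singleton, map_prod]

/-- **`(z₁ ⋯ z_r)` is an SNC ideal** for a regular system of parameters `z₁, …, z_d` of a regular
local ring (`1 ≤ r ≤ d`): split `z` at `r`. [cite: StacksProject, Tag 0BI9] -/
theorem isSNCIdeal_span_prod_filter_lt {A : Type u} [CommRing A] [IsRegularLocalRing A] {d r : ℕ}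
    (z : Fin d → A) (hz : Ideal.span (Set.range z) = maximalIdeal A) (hd : ringKrullDim A = d)
    (h1 : 1 ≤ r) (hrd : r ≤ d) {I : Ideal A}
    (hI : I = Ideal.span {∏ i ∈ Finset.univ.filter (fun i : Fin d => i.val < r), z i}) :
    IsSNCIdeal I := by
  refine ⟨inferInstance, r, d - r, fun j => z (Fin.castLE hrd j), fun j => z ⟨r + j.val, by omega⟩,
    h1, ?_, ?_, ?_⟩
  · rw [hd, Nat.add_sub_cancel' hrd]
  · rw [← range_eq_range_castLE_union hrd z, hz]
  · rw [hI, prod_filter_lt_eq_prod_castLE hrd]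

/-! ## The regular system of parameters at a closed point of the smooth locus, over any field -/

section Local

variable {k : Type u} [Field k] {X Y : Scheme.{u}} {f : X ⟶ Y} {g : Y ⟶ Spec (.of k)}
  {D : Set Y} {n : ℕ} {τ : Fin n → (Y ⟶ X)}

/-- **de Jong 1996, 4.24: "`Z` is already everywhere a divisor with normal crossings, except in
the singular points of `X`" — at the closed points of the smooth locus of `f`, in strict
Zariski-local form, over an ARBITRARY field.** For a pair in Situation 4.23, `dim X = d`, and a
closed point `x` of an open on which `f` is smooth, lying on `Z`: `𝒪_{X,x}` (regular of dimension
`d`) has generators `z₁, …, z_d` of its maximal ideal with `I(Z)_x = (z₁ ⋯ z_r)`, `1 ≤ r ≤ d`. The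
tree's `SemiStablePair.exists_rsop_stalkIdeal_boundary_of_smooth` verbatim, its three algebraically
closed inputs (the dimension count `dim 𝒪_{X,x} = dim 𝒪_{Y,f x} + 1`, the principality of the germ
of a section, the fibre dimension `1`) replaced by `ringKrullDim_stalk_eq_base_add_one_of_isClosed`,
`exists_stalkIdeal_ker_eq_span_singleton_of_isClosed`, `ringKrullDim_stalk_fiber_eq_one_of_isClosed`.
[cite: DeJong1996, 4.24, p. 75] -/
theorem exists_rsop_stalkIdeal_boundary_of_smooth' (hS : DeJong1996.SemiStablePair f g D τ)
    {d : ℕ} (hd : topologicalKrullDim X = d) {U : X.Opens} (hU : Smooth (U.ι ≫ f)) {x : X}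
    (hxU : x ∈ U) (hx : IsClosed ({x} : Set X)) (hxZ : x ∈ DeJong1996.semiStableBoundary f D τ) :
    ∃ (z : Fin d → X.presheaf.stalk x) (r : ℕ), 1 ≤ r ∧ r ≤ d ∧
      Ideal.span (Set.range z) = maximalIdeal (X.presheaf.stalk x) ∧
      ringKrullDim (X.presheaf.stalk x) = d ∧
      stalkIdeal (vanishingIdeal ⟨DeJong1996.semiStableBoundary f D τ,
          hS.isClosed_semiStableBoundary⟩) x =
        Ideal.span {∏ i ∈ Finset.univ.filter (fun i : Fin d => i.val < r), z i} := by
  classical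
  haveI := hS.isIntegral
  haveI := hS.locallyOfFiniteType
  haveI := hS.isNoetherian_base
  -- `B = 𝒪_{X,x}` regular of dimension `d`, `A = 𝒪_{Y,f x}`, `φ = f_x^#`
  haveI hB : IsRegularLocalRing (X.presheaf.stalk x) := hS.isRegularLocalRing_of_smooth hU hxU
  haveI : IsDomain (X.presheaf.stalk x) := isDomain_of_isRegularLocalRing _
  have hdimB : ringKrullDim (X.presheaf.stalk x) = d := by
    rw [ringKrullDim_stalk_eq_of_isClosed (f ≫ g) hx, hd]
  set φ := (f.stalkMap x).hom with hφ
  haveI : IsLocalHom φ := inferInstanceAs (IsLocalHom (f.stalkMap x).hom)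
  -- the base data at `f x`
  obtain ⟨ρ, e, t, s, hdimA, hspanA, hIA, hρ⟩ := hS.exists_rsop_stalkIdeal_base (f x)
  -- `d = ρ + e + 1`
  have hdAB := ringKrullDim_stalk_eq_base_add_one_of_isClosed hS hx
  rw [hdimB, hdimA] at hdAB
  obtain rfl : d = ρ + e + 1 := by
    have h1 : ((d : ℕ∞) : WithBot ℕ∞) = ((ρ + e : ℕ) : ℕ∞) + 1 := by exact_mod_cast hdAB
    have h2 : (d : ℕ∞) = (ρ + e : ℕ) + 1 := by exact_mod_cast h1
    exact_mod_cast h2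
  -- the stalk of the ideal of `f⁻¹(D)` at `x`
  set t' : Fin ρ → X.presheaf.stalk x := fun i => φ (t i) with ht'
  set s' : Fin e → X.presheaf.stalk x := fun i => φ (s i) with hs'
  have hID : stalkIdeal (vanishingIdeal ((⟨D, hS.isStrictNormalCrossingsDivisor.isClosed⟩ :
      Closeds Y).preimage f.continuous)) x = (Ideal.span {∏ i, t' i}).radical := by
    rw [stalkIdeal_vanishingIdeal_preimage, hIA, Ideal.map_span, Set.image_singleton, map_prod]
  have hmapA : (maximalIdeal (Y.presheaf.stalk (f x))).map φ =
      Ideal.span (Set.range t' ∪ Set.range s') := by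
    rw [← hspanA, Ideal.map_span, Set.image_union, ← Set.range_comp, ← Set.range_comp]
    rfl
  by_cases hsec : ∃ i, x ∈ Set.range (τ i)
  · /- Case A: `x = τᵢ(y)` lies on a section -/
    obtain ⟨i, y, rfl⟩ := hsec
    haveI := hS.isClosedImmersion i
    -- `(p) = ker ψ`, `ψ = τᵢ^#`
    set ψ := ((τ i).stalkMap y).hom with hψ
    haveI : IsLocalHom ψ := inferInstanceAs (IsLocalHom ((τ i).stalkMap y).hom)
    obtain ⟨p, hp0, hPp⟩ := exists_stalkIdeal_ker_eq_span_singleton_of_isClosed hS i y hx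
    have hker : RingHom.ker ψ = Ideal.span {p} := by
      rw [← stalkIdeal_ker_eq_ker_stalkMap, hPp]
    -- `ψ ∘ φ` is the isomorphism `𝒪_{Y, f(τ y)} ≅ 𝒪_{Y,y}`
    have hcomp : (τ i ≫ f).stalkMap y = f.stalkMap (τ i y) ≫ (τ i).stalkMap y :=
      Scheme.Hom.stalkMap_comp (τ i) f y
    rw [Scheme.Hom.stalkMap_congr_hom (τ i ≫ f) (𝟙 Y) (hS.comp_eq_id i) y] at hcomp
    let κ := (Y.presheaf.stalkCongr (.of_eq <| (hS.comp_eq_id i) ▸ rfl) :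
      Y.presheaf.stalk ((τ i ≫ f) y) ≅ Y.presheaf.stalk ((𝟙 Y : Y ⟶ Y) y)).commRingCatIsoToRingEquiv
    have hψφ : ∀ a, ψ (φ a) = κ a := fun a => by
      have h := congrArg (fun h => h.hom a) hcomp
      simp only [CommRingCat.hom_comp, RingHom.comp_apply, Scheme.Hom.stalkMap_id] at h
      exact h.symm
    -- `𝔪_B = (p) + φ(𝔪_A) B`
    have hmB : maximalIdeal (X.presheaf.stalk (τ i y)) =
        Ideal.span ({p} ∪ (Set.range t' ∪ Set.range s')) := by
      rw [maximalIdeal_eq_ker_sup_map φ ψ κ hψφ, hker, hmapA, ← Ideal.span_union]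
    -- the regular system of parameters `z = (p, t', s')`
    let z : Fin (ρ + e + 1) → X.presheaf.stalk (τ i y) := Fin.cons p (Fin.append t' s')
    have hz : Ideal.span (Set.range z) = maximalIdeal _ := by
      rw [hmB, Fin.range_cons, range_fin_append, Set.insert_eq]
    have hdimB' : ringKrullDim (X.presheaf.stalk (τ i y)) = ((ρ + e + 1 : ℕ) : ℕ) := hdimB
    -- the members of `z` are pairwise non-associated primes
    have hzp : ∀ j, Prime (z j) := fun j => prime_of_rsop z hz hdimB' j
    have hzn : ∀ j j', j ≠ j' → ¬ z j ∣ z j' := fun j j' h => not_dvd_of_rsop z hz hdimB' h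
    have ht'z : ∀ j : Fin ρ, t' j = z (Fin.succ (Fin.castAdd e j)) := fun j => by
      simp only [z, Fin.cons_succ, Fin.append_left]
    have hpz : p = z 0 := rfl
    have ht'p : ∀ j : Fin ρ, Prime (t' j) := fun j => (ht'z j).symm ▸ hzp _
    have ht'n : ∀ j ∈ (Finset.univ : Finset (Fin ρ)), ∀ j' ∈ (Finset.univ : Finset (Fin ρ)),
        j ≠ j' → ¬ t' j ∣ t' j' := fun j _ j' _ hjj' => by
      rw [ht'z, ht'z]
      exact hzn _ _ (fun h => hjj' (Fin.castAdd_injective _ _ (Fin.succ_injective _ h)))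
    -- `I(f⁻¹D)_x = (t'₁ ⋯ t'_ρ)`
    have hrad : (Ideal.span {∏ j, t' j}).radical = Ideal.span {∏ j, t' j} :=
      Ideal.radical_span_singleton_prod_eq t' Finset.univ (fun j _ => ht'p j) ht'n
    -- `I(Z)_x = (p) ∩ (∏ t') = (p ∏ t')`
    have hsecs : (Finset.univ.inf fun j => stalkIdeal (vanishingIdeal
        ⟨Set.range (τ j), (hS.isClosedImmersion j).isClosedEmbedding.isClosed_range⟩) (τ i y)) =
        Ideal.span {p} := by
      apply le_antisymm
      · refine (Finset.inf_le (Finset.mem_univ i)).trans ?_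
        rw [hS.stalkIdeal_vanishingIdeal_range_self i y, hker]
      · refine Finset.le_inf fun j _ => ?_
        by_cases hji : j = i
        · subst hji
          rw [hS.stalkIdeal_vanishingIdeal_range_self j y, hker]
        · rw [hS.stalkIdeal_vanishingIdeal_range_eq_top j]
          · exact le_top
          · intro hmem
            exact Set.disjoint_left.mp (hS.pairwise_disjoint (Ne.symm hji)) ⟨y, rfl⟩ hmem
    have hinf : Ideal.span {p} ⊓ Ideal.span {∏ j, t' j} = Ideal.span {p * ∏ j, t' j} :=
      Ideal.span_singleton_inf_span_singleton_prod t' Finset.univ (fun j _ => ht'p j) ht'n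
        (hpz ▸ hzp 0) (fun j _ => by rw [hpz, ht'z]; exact hzn _ _ (Fin.succ_ne_zero _).symm)
    refine ⟨z, ρ + 1, Nat.succ_le_succ (Nat.zero_le ρ), by omega, hz, hdimB', ?_⟩
    rw [hS.stalkIdeal_vanishingIdeal_semiStableBoundary, hsecs, hID, hrad, hinf]
    refine congrArg (fun a => Ideal.span {a}) ?_
    change p * ∏ j ∈ Finset.univ, t' j =
      ∏ j ∈ Finset.univ.filter (fun j : Fin (ρ + e + 1) => j.val < ρ + 1),
        Fin.cons p (Fin.append t' s') j
    rw [Fin.prod_filter_lt_cons, Fin.prod_filter_lt_append]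
  · /- Case B: `x` lies on no section, hence on `f⁻¹(D)` -/
    push Not at hsec
    have hxD : f x ∈ D := by
      rcases (DeJong1996.mem_semiStableBoundary_iff f D τ x).mp hxZ with ⟨i, hi⟩ | h
      · exact (hsec i hi).elim
      · exact h
    have hρ1 : 1 ≤ ρ := hρ hxD
    -- the fibre ring `B/𝔪_A B = 𝒪_{X_{f x}, x}` is a discrete valuation ring
    obtain ⟨eF⟩ := Literature.AlgebraicGeometry.Motives.nonempty_stalkFiber_ringEquiv_asFiber f x
    haveI hFreg : IsRegularLocalRing
        (X.presheaf.stalk x ⧸ (maximalIdeal (Y.presheaf.stalk (f x))).map φ) :=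
      haveI := isRegularLocalRing_stalk_fiber_of_smooth f hU hxU
      IsRegularLocalRing.of_ringEquiv eF
    have hFdim : ringKrullDim
        (X.presheaf.stalk x ⧸ (maximalIdeal (Y.presheaf.stalk (f x))).map φ) = 1 := by
      rw [← ringKrullDim_eq_of_ringEquiv eF, ringKrullDim_stalk_fiber_eq_one_of_isClosed hS hx]
    obtain ⟨w', hw'⟩ := exists_maximalIdeal_eq_span_singleton_of_ringKrullDim_eq_one hFdim
    obtain ⟨w, rfl⟩ := Ideal.Quotient.mk_surjective w'
    have hJm : (maximalIdeal (Y.presheaf.stalk (f x))).map φ ≤ maximalIdeal (X.presheaf.stalk x) := by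
      rw [Ideal.map_le_iff_le_comap]
      intro a ha
      exact map_nonunit φ a ha
    -- `𝔪_B = φ(𝔪_A) B + (w)`
    have hmB : maximalIdeal (X.presheaf.stalk x) =
        Ideal.span ((Set.range t' ∪ Set.range s') ∪ {w}) := by
      have h := maximalIdeal_eq_sup_span_of_quotient hJm w hw'
      rw [hmapA] at h
      rw [h, ← Ideal.span_union]
    -- the regular system of parameters `z = (t', s', w)`, reindexed to `Fin (ρ + e + 1)`
    set ε : Fin (ρ + e + 1) ≃ Fin (ρ + (e + 1)) := finCongr (Nat.add_assoc ρ e 1) with hε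
    let z₀ : Fin (ρ + (e + 1)) → X.presheaf.stalk x :=
      Fin.append t' (Fin.append s' (fun _ : Fin 1 => w))
    let z : Fin (ρ + e + 1) → X.presheaf.stalk x := z₀ ∘ ε
    have hrange : Set.range z = Set.range z₀ := ε.surjective.range_comp z₀
    have hz : Ideal.span (Set.range z) = maximalIdeal _ := by
      rw [hrange, hmB]
      simp only [z₀, range_fin_append, Set.range_const, Set.union_assoc]
    have hzp : ∀ j, Prime (z j) := fun j => prime_of_rsop z hz hdimB j
    have hzn : ∀ j j', j ≠ j' → ¬ z j ∣ z j' := fun j j' h => not_dvd_of_rsop z hz hdimB h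
    have ht'z : ∀ j : Fin ρ, t' j = z (ε.symm (Fin.castAdd (e + 1) j)) := fun j => by
      simp only [z, z₀, Function.comp_apply, Equiv.apply_symm_apply, Fin.append_left]
    have ht'p : ∀ j : Fin ρ, Prime (t' j) := fun j => (ht'z j).symm ▸ hzp _
    have ht'n : ∀ j ∈ (Finset.univ : Finset (Fin ρ)), ∀ j' ∈ (Finset.univ : Finset (Fin ρ)),
        j ≠ j' → ¬ t' j ∣ t' j' := fun j _ j' _ hjj' => by
      rw [ht'z, ht'z]
      exact hzn _ _ (fun h => hjj' (Fin.castAdd_injective _ _ (ε.symm.injective h)))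
    have hrad : (Ideal.span {∏ j, t' j}).radical = Ideal.span {∏ j, t' j} :=
      Ideal.radical_span_singleton_prod_eq t' Finset.univ (fun j _ => ht'p j) ht'n
    have hsecs : (Finset.univ.inf fun j => stalkIdeal (vanishingIdeal
        ⟨Set.range (τ j), (hS.isClosedImmersion j).isClosedEmbedding.isClosed_range⟩) x) = ⊤ := by
      refine le_antisymm le_top (Finset.le_inf fun j _ => ?_)
      rw [hS.stalkIdeal_vanishingIdeal_range_eq_top j (hsec j)]
    refine ⟨z, ρ, hρ1, by omega, hz, hdimB, ?_⟩
    rw [hS.stalkIdeal_vanishingIdeal_semiStableBoundary, hsecs, top_inf_eq, hID, hrad]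
    refine congrArg (fun a => Ideal.span {a}) ?_
    rw [Finset.prod_filter]
    have hF : ∀ j : Fin (ρ + e + 1), (if j.val < ρ then z j else 1) =
        (fun i : Fin (ρ + (e + 1)) => if i.val < ρ then z₀ i else 1) (ε j) := fun j => by
      simp only [z, Function.comp_apply, hε, finCongr_apply, Fin.val_cast]
    simp_rw [hF]
    rw [Equiv.prod_comp ε (fun i : Fin (ρ + (e + 1)) => if i.val < ρ then z₀ i else 1),
      ← Finset.prod_filter]
    change ∏ j ∈ Finset.univ, t' j =
      ∏ j ∈ Finset.univ.filter (fun j : Fin (ρ + (e + 1)) => j.val < ρ),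
        Fin.append t' (Fin.append s' (fun _ : Fin 1 => w)) j
    rw [Fin.prod_filter_lt_append]

end Local

/-! ## 4.25 (i) at the closed points of the smooth locus -/

/-- **de Jong 1996, 4.25 (i) at a closed point of the smooth locus of `f`, over an arbitrary
field, in the form of `DeJong1997.QuasiSplitNormalFormPair.isSNCIdeal_completedStalkIdeal`**: for a
pair in Situation 4.23 and a closed point `x ∈ Z = ⋃ τᵢ(Y) ∪ f⁻¹(D)` of an open on which `f` is
smooth (so `𝒪_{X,x}` is regular, which the statement takes as an instance, as does the field), the
completed ideal of `Z` in `𝒪̂_{X,x}` has local strict normal crossings data: `I(Z)_x`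
is the product of the first `r` members of a regular system of parameters of `𝒪_{X,x}`
(`exists_rsop_stalkIdeal_boundary_of_smooth'`), and this passes to the completion
(`isSNCIdeal_map_algebraMap_adicCompletion`). [cite: DeJong1996, 4.24–4.25 (i), p. 75] -/
theorem isSNCIdeal_completedStalkIdeal_boundary_of_smooth {k : Type u} [Field k] {X Y : Scheme.{u}}
    {f : X ⟶ Y} {g : Y ⟶ Spec (.of k)} {D : Set Y} {n : ℕ} {τ : Fin n → (Y ⟶ X)}
    (hS : DeJong1996.SemiStablePair f g D τ) {U : X.Opens} (hU : Smooth (U.ι ≫ f)) {x : X}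
    (hxU : x ∈ U) (hx : IsClosed ({x} : Set X)) [IsRegularLocalRing (X.presheaf.stalk x)]
    (hxZ : x ∈ DeJong1996.semiStableBoundary f D τ) (V : X.affineOpens) (hV : x ∈ (V : X.Opens)) :
    IsSNCIdeal (completedStalkIdeal (vanishingIdeal ⟨DeJong1996.semiStableBoundary f D τ,
      hS.isClosed_semiStableBoundary⟩) x V hV) := by
  haveI := hS.isIntegral
  haveI := hS.locallyOfFiniteType
  haveI := hS.isNoetherian
  haveI : CompactSpace X :=
    (HasAffineProperty.iff_of_isAffine (P := @QuasiCompact)).mp hS.quasiCompact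
  obtain ⟨d₀, hd₀⟩ := exists_topologicalKrullDim_le_of_locallyOfFiniteType (f ≫ g)
  obtain ⟨d, hd⟩ := exists_topologicalKrullDim_eq_nat hd₀
  obtain ⟨z, r, h1, hrd, hz, hdim, hI⟩ :=
    exists_rsop_stalkIdeal_boundary_of_smooth' hS hd hU hxU hx hxZ
  rw [completedStalkIdeal_eq_map_stalkIdeal]
  exact isSNCIdeal_map_algebraMap_adicCompletion (isSNCIdeal_span_prod_filter_lt z hz hdim h1 hrd hI)

end Summit.ResolutionOfSingularities.ResolutionOfSingularities.Theorems

end
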